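import Summits.ABC.ABC.Theorems.CuspFieldPencilNFPencilThreeForms
import Summits.ABC.ABC.Theorems.CuspFieldPencilNFPencilReduction
import Summits.ABC.ABC.Theorems.CuspFieldPencilGoldenFromNFPencil
import Literature.NumberTheory.NumberFields.PlacesOfRingEquivNorms
import HarnessLib

/-!
# STUB-IDEAS sketch (ideator k=2, RESHAPE) for `stub_splitCuspTriple` of crux stmt-ABC-26026 `GoldenCuspShadow`

Elaboration sanity only: helper-lemma STATEMENTS (proofs `sorry`) and the two compositions.
Not a proposal; nothing here is landed.
-/

set_option linter.dupNamespace false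

namespace Summit.ABC.ABC.Theorems.StubSplitCuspIdeas

open NumberField UniqueFactorizationMonoid QuadraticAlgebra

/-- The registered stub, verbatim (= `Sig.stub_splitCuspTriple` of the birth skeleton). -/
def StubSplit : Prop :=
  ∀ ε : ℝ, 0 < ε → ∃ κ : ℝ, ∀ u w : ℤ, IsCoprime u w → u * w * (u ^ 2 - 11 * u * w - w ^ 2) ≠ 0 → Real.log (max (|(u : ℝ)|) (|(w : ℝ)|)) ≤ κ * (((UniqueFactorizationMonoid.radical (u * w * (u ^ 2 - 11 * u * w - w ^ 2))).natAbs : ℕ) : ℝ) ^ (ε : ℝ) * (((((UniqueFactorizationMonoid.radical u).natAbs : ℕ) : ℝ) * (((UniqueFactorizationMonoid.radical w).natAbs : ℕ) : ℝ)) ^ (2 / 3 : ℝ) * (((UniqueFactorizationMonoid.radical (u ^ 2 - 11 * u * w - w ^ 2)).natAbs : ℕ) : ℝ) ^ (1 / 3 : ℝ))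

/-- The THREE-FORMS pencil statement (= hypothesis `h3` of `nfPencilBound_of_threeForms`; = conclusion of
`NFPencilThreeForms.threeForms_of_scoones2021`; registered `stub_threeForms` of stmt-ABC-26250 at `k = 3`). -/
def ThreeFormsPencil : Prop :=
  ∀ (K : Type) [Field K] [NumberField K], IsPrincipalIdealRing (𝓞 K) →
    ∀ (α β : Fin 3 → 𝓞 K), (∀ i j, i ≠ j → α i * β j ≠ α j * β i) → ∀ ε : ℝ, 0 < ε →
      ∃ C : ℝ, ∀ u w : ℤ, IsCoprime u w →
        (∏ i, (α i * (u : 𝓞 K) + β i * (w : 𝓞 K))) ≠ 0 →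
          Real.log ((max |u| |w| : ℤ) : ℝ) ≤ C *
            ((∏ i, Ideal.absNorm (Ideal.span {α i * (u : 𝓞 K) + β i * (w : 𝓞 K)}).radical : ℕ) : ℝ) ^
              (1 / (3 : ℝ) + ε)

/-! ## H1 — conjugate-pair cost (generic `K`; = the inline block `h23` of `goldenFromNFPencil_proof`, extracted) -/

/-- H1. For a number field `K`, `θ ∈ 𝓞_K` with `θ² = θ + 1`, coprime `u, w` and `Q = u² − 11uw − w² ≠ 0`:
`N(rad(u+β₂w)) · N(rad(u+β₃w)) ≤ N((5(2θ−1))) · rad(Q)^[K:ℚ]` (`β₂ = −3−5θ`, `β₃ = −8+5θ`, `β₂β₃ = −1`,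
`β₂+β₃ = −11`, `5(2θ−1) = 5√5 ∈ (u+β₂w, u+β₃w)`; gcd·lcm identity for radicals). [folklore] -/
theorem conjPair_absNorm_radical_mul_le (K : Type) [Field K] [NumberField K]
    (θ : 𝓞 K) (hθ : θ * θ = θ + 1) {u w : ℤ} (hcop : IsCoprime u w)
    (hQ : u ^ 2 - 11 * u * w - w ^ 2 ≠ 0) :
    Ideal.absNorm (Ideal.span {(u : 𝓞 K) + (-3 - 5 * θ) * (w : 𝓞 K)}).radical *
        Ideal.absNorm (Ideal.span {(u : 𝓞 K) + (-8 + 5 * θ) * (w : 𝓞 K)}).radical ≤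
      Ideal.absNorm (Ideal.span {(5 * (2 * θ - 1) : 𝓞 K)}) *
        (radical (u ^ 2 - 11 * u * w - w ^ 2)).natAbs ^ Module.finrank ℚ K := by
  sorry

/-! ## H2 — symmetrisation, variant (a): the minimum of the conjugate pair (pure ℕ) -/

/-- H2a. `m·n ≤ C·r²` ⇒ `min(m,n)² ≤ C·r²`. [folklore] -/
theorem min_sq_le_of_mul_le {m n C r : ℕ} (h : m * n ≤ C * r ^ 2) : (min m n) ^ 2 ≤ C * r ^ 2 := by
  sorry

/-! ## H2 — symmetrisation, variant (b): the Galois involution of `ℚ(√5)` (`star` of `QuadraticAlgebra ℚ 1 1`) -/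

section Golden
variable [Fact (∀ r : ℚ, r ^ 2 ≠ (1 : ℚ) + 1 * r)]

/-- H2b. `N(rad(σI)) = N(rad I)` for the involution `σ = star` (`ω ↦ 1 − ω`) of `K = ℚ(√5)` acting on `𝓞_K`
(tree: `Literature.NumberTheory.NumberFields.absNorm_map_mapRingEquiv`; Mathlib `Ideal.map_radical_of_surjective`).
[folklore] -/
theorem absNorm_radical_map_star (I : Ideal (𝓞 (QuadraticAlgebra ℚ 1 1))) :
    haveI := GoldenField.numberField
    Ideal.absNorm (Ideal.map (RingOfIntegers.mapRingEquiv
        (starRingAut : QuadraticAlgebra ℚ 1 1 ≃+* QuadraticAlgebra ℚ 1 1) :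
          𝓞 (QuadraticAlgebra ℚ 1 1) →+* 𝓞 (QuadraticAlgebra ℚ 1 1)) I).radical =
      Ideal.absNorm I.radical := by
  sorry

/-- H2b'. The involution swaps the conjugate cusp forms: `σ(u + β₂w) = u + β₃w` (`σθ = 1 − θ`), hence
`G₊ = G₋` := `N(rad(u+β₂w)) = N(rad(u+β₃w))`. [folklore] -/
theorem absNorm_radical_conj_eq (u w : ℤ) :
    haveI := GoldenField.numberField
    let θ : 𝓞 (QuadraticAlgebra ℚ 1 1) := ⟨ω, GoldenField.isIntegral_omega⟩
    Ideal.absNorm (Ideal.span {(u : 𝓞 (QuadraticAlgebra ℚ 1 1)) + (-3 - 5 * θ) * w}).radical =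
      Ideal.absNorm (Ideal.span {(u : 𝓞 (QuadraticAlgebra ℚ 1 1)) + (-8 + 5 * θ) * w}).radical := by
  sorry

end Golden

/-! ## H3 — weighted real-arithmetic endgame -/

/-- H3. From `L ≤ C·X^{1/3+ε/2}` and `X² ≤ C₀·(A²B)²` (naturals, `B ≥ 1`):
`L ≤ (max C 0 · C₀^{(1/3+ε/2)/2}) · (AB)^ε · A^{2/3} · B^{1/3}`. [folklore] -/
theorem real_step_weighted {L C ε : ℝ} {X C₀ A B : ℕ} (hε : 0 < ε) (hB : 1 ≤ B)
    (hL : L ≤ C * (X : ℝ) ^ (1 / (3 : ℝ) + ε / 2)) (hX : X ^ 2 ≤ C₀ * (A ^ 2 * B) ^ 2) :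
    L ≤ (max C 0 * (C₀ : ℝ) ^ ((1 / (3 : ℝ) + ε / 2) / 2)) *
      (((A * B : ℕ) : ℝ)) ^ (ε : ℝ) * (A : ℝ) ^ (2 / 3 : ℝ) * (B : ℝ) ^ (1 / 3 : ℝ) := by
  sorry

/-! ## Compositions -/

/-- T0 (unconditional, 5 lines): the route's parametric crux at `k = 3` is the three-forms statement. -/
theorem threeFormsPencil_of_nfPencilBound
    (h : Summit.ABC.ABC.Theses.CuspFieldPencil.NFPencilBound) : ThreeFormsPencil := by
  intro K _ _ hPID α β hprop ε hε
  obtain ⟨C, hC⟩ := h K hPID 3 α β le_rfl hprop ε hε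
  refine ⟨C, fun u w hcop hne => ?_⟩
  have := hC u w hcop hne
  simpa using this

/-- T1 (UNCONDITIONAL reduction, the real work of the cycle, ~120 lines): the stub is the golden `k = 3` instance
of the three-forms pencil statement, run on BOTH unit cusp triples `{u, w, u+β₂w}`, `{u, w, u+β₃w}` and minimised
(H1 + H2a, or H2b), then H3. -/
theorem stubSplit_of_threeForms (h3 : ThreeFormsPencil) : StubSplit := by
  sorry

/-- T2 (PROVED-MOD-FACT corollary, 1 line): the stub modulo the cite-only Scoones fact. -/
theorem stubSplit_of_scoones2021
    (hS : Literature.NumberTheory.DiophantineGeometry.scoones2021_abcNumberField_classNumberOne) :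
    StubSplit :=
  stubSplit_of_threeForms (NFPencilThreeForms.threeForms_of_scoones2021 hS)

/-- T2' (unconditional relative to the sibling crux stmt-ABC-26250). -/
theorem stubSplit_of_nfPencilBound (h : Summit.ABC.ABC.Theses.CuspFieldPencil.NFPencilBound) : StubSplit :=
  stubSplit_of_threeForms (threeFormsPencil_of_nfPencilBound h)

end Summit.ABC.ABC.Theorems.StubSplitCuspIdeas
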